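import Summits.HodgeConjecture.CorCM.GaloisTwoPowerCyclicNormalSquares
import Summits.HodgeConjecture.CorCM.GaloisTwoPowerDescentStructure
import HarnessLib

/-!
# The index-two world of the `2`-power classification, unconditionally: an abelian subgroup of index two containing `c` has at
# most three involutions and no `C₄ × C₄`

COR-CM (cell `pub-hodgecm2`), binder seat b04 (gen 35), count-neutral own lane «Galois-CM-type classification».  KERNEL ONLY:
theorems; no definition, no named fact, no `sorry`.  `HC_CM` is neither used nor claimed.

`K` Galois CM of degree `2^n`, `n ≥ 6`, GOOD (every primitive CM type nondegenerate); `A ≤ Gal(K/ℚ)` an ABELIAN subgroup of index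
`2` containing complex conjugation `c` (the setting of gens 28–31).  Gen 32 makes every involution of `Gal(K/ℚ)` central, and gen 30's
two-cyclic criterion (`SplitInvolution.exists_simple_degenerate_of_two_cyclic`: two `c`-avoiding cyclic subgroups `⟨u₀⟩, ⟨u₁⟩ ≤ A`
in general position with `4·|uᵢ| < |A|` ⟹ BAD) then gives, WITHOUT any degree-`32` hypothesis:

* `exists_simple_degenerate_of_index_two_pair` — the two-cyclic criterion with its plumbing done once: `u₀, u₁ ∈ A` with `c ∉ ⟨u₀⟩`,
  `c ∉ ⟨u₁⟩`, `u₁ ∉ ⟨u₀, c⟩`, `⟨u₀⟩ ∩ ⟨u₁⟩ = 1`, no conjugate of `u₀` in `⟨u₁⟩`, `4·|uᵢ| < 2^(n-1)` ⟹ BAD.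
* **`mem_closure_of_involutions_of_index_two_abelian`** — GOOD ⟹ the involutions of `A` lie in `⟨t₁, c⟩` for any involution
  `t₁ ≠ c` of `A`: `A` (hence `Gal(K/ℚ)`, if non-abelian) has at most three involutions — **`rank Ω₁ ≤ 2`** (three independent
  involutions `c, t₁, t₂ ∈ A` would be a two-cyclic pair).
* **`exists_mem_zpowers_of_order_four_of_index_two_abelian`** — GOOD ⟹ two elements `g₁, h₁ ∈ A` of order `4` always have
  `⟨g₁⟩ ∩ ⟨h₁⟩ ≠ 1`: **no `C₄ × C₄ ≤ A`** (`u₀, u₁` chosen among `g₁, h₁, g₁h₁` according to the position of `c` in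
  `{g₁², h₁², g₁²h₁²}`; a conjugate of `u₀` has square `u₀²`, which is not a square in `⟨u₁⟩`).
So in a GOOD field `A` is `C_{2^(n-1)}` — then `CorCM/GaloisTwoPowerCyclicNormalSquares` structures `Gal(K/ℚ)` — or of type
`C_{2^(n-2)} × C₂` (the residual case of A7-JUNCTION gen-34 §C, settled there by hand over each action and here left to the conditional
classification `CorCM/GaloisTwoPowerClassification`).

## References

* [Kubota1965] T. Kubota, *On the field extension by complex multiplication*, Trans. AMS 118 (1965), §2 and §4 Lemma 2.
* [Shimura1998] G. Shimura, *Abelian Varieties with Complex Multiplication and Modular Functions*, §6.2 Thm. 3, §8.2 Prop. 26.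
* [Gordon1999HodgeAVSurvey] B. B. Gordon, *A survey of the Hodge conjecture for abelian varieties*, Thm. 6.4, §9.3.
-/

noncomputable section

open CategoryTheory CategoryTheory.Limits NumberField
open scoped BigOperators

namespace Summit.HodgeConjecture.CorCM.GaloisModels

open Literature.NumberTheory.ComplexMultiplication
open Literature.AlgebraicGeometry.Motives (AbelianVariety CMType)
open Literature.AlgebraicGeometry.HodgeTheory
open Literature.AlgebraicGeometry.ComplexMultiplication (IsCMTypeRealisation)
open Literature.AlgebraicGeometry.Pohlmann1968
open Literature.Barriers.HodgeConjecture (divisorClassesSpan)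
open Summit.HodgeConjecture.CorCM.GaloisRank

variable {K : Type} [Field K] [NumberField K] [IsCMField K] [IsGalois ℚ K]

/-- **The two-cyclic criterion in an abelian subgroup of index two** (plumbing of gen 30's
`SplitInvolution.exists_simple_degenerate_of_two_cyclic`).  `K` Galois CM of degree `2^n`; `A ≤ Gal(K/ℚ)` abelian of index `2`
containing `c`; `u₀, u₁ ∈ A` with `c ∉ ⟨u₀⟩`, `c ∉ ⟨u₁⟩`, `u₀ ≠ 1`, `u₁ ∉ ⟨u₀, c⟩`, `⟨u₀⟩ ∩ ⟨u₁⟩ = 1`, no conjugate of `u₀` in `⟨u₁⟩`,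
`4·orderOf uᵢ < 2^(n-1)`.  Then `K` carries a simple degenerate abelian variety of dimension `[K:ℚ]/2` with CM by `K`.
[cite: Kubota1965, §2 and §4 Lemma 2] [cite: Shimura1998, §6.2 Thm. 3 and §8.2 Prop. 26] [cite: Gordon1999HodgeAVSurvey, Thm. 6.4 and §9.3] -/
theorem exists_simple_degenerate_of_index_two_pair {n : ℕ} (hdeg : Module.finrank ℚ K = 2 ^ n) (hn : 1 ≤ n)
    (A : Subgroup (K ≃ₐ[ℚ] K)) (hAidx : A.index = 2) (hcommA : ∀ u ∈ A, ∀ v ∈ A, u * v = v * u)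
    (hcA : (IsCMField.complexConj K).restrictScalars ℚ ∈ A) (u₀ u₁ : K ≃ₐ[ℚ] K) (hu₀A : u₀ ∈ A) (hu₁A : u₁ ∈ A)
    (hcu₀ : (IsCMField.complexConj K).restrictScalars ℚ ∉ Subgroup.zpowers u₀)
    (hcu₁ : (IsCMField.complexConj K).restrictScalars ℚ ∉ Subgroup.zpowers u₁) (hu₀ : u₀ ≠ 1)
    (hind : u₁ ∉ Subgroup.closure ({u₀, (IsCMField.complexConj K).restrictScalars ℚ} : Set (K ≃ₐ[ℚ] K)))
    (hint : ∀ w : K ≃ₐ[ℚ] K, w ∈ Subgroup.zpowers u₀ → w ∈ Subgroup.zpowers u₁ → w = 1)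
    (hconjU : ∀ g : K ≃ₐ[ℚ] K, g * u₀ * g⁻¹ ∉ Subgroup.zpowers u₁)
    (hQ₀ : 4 * orderOf u₀ < 2 ^ (n - 1)) (hQ₁ : 4 * orderOf u₁ < 2 ^ (n - 1)) :
    ∃ (Φ : CMType K) (φ : K →+* ℂ) (X : AbelianVariety ℂ) (ι : 𝓞 K →+* End X)
      (ϑ : K →+* Module.End ℂ (complexBetti X.X 1)),
      IsPrimitive (ℂ ≃+* ℂ) Φ.1 φ ∧ ¬ IsNondegenerate Φ ∧ IsCMTypeRealisation Φ X ι ϑ ∧ X.IsSimple ∧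
      X.dim = Fintype.card (K ≃ₐ[ℚ] K) / 2 ∧
      ∃ m p : ℕ, ∃ z : complexBetti (⨁ fun _ : Fin m => X).X (2 * p), IsRationalClass z ∧
        IsOfHodgeType (⨁ fun _ : Fin m => X).dim (⨁ fun _ : Fin m => X).X (2 * p) p p z ∧
        z ∉ divisorClassesSpan (⨁ fun _ : Fin m => X).X (⨁ fun _ : Fin m => X).dim p := by
  classical
  set c := (IsCMField.complexConj K).restrictScalars ℚ with hc
  have hcard : Nat.card (K ≃ₐ[ℚ] K) = 2 ^ n := by
    rw [Nat.card_eq_fintype_card, card_model_eq_finrank (MulEquiv.refl (K ≃ₐ[ℚ] K)), hdeg]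
  haveI hAn : A.Normal := Subgroup.normal_of_index_eq_two hAidx
  letI : CommGroup A := { (inferInstance : Group A) with mul_comm := fun u v => Subtype.ext (hcommA u u.2 v v.2) }
  have hAcard : Nat.card A = 2 ^ (n - 1) := by
    have h1 := A.index_mul_card
    rw [hAidx, hcard, show 2 ^ n = 2 * 2 ^ (n - 1) by rw [← pow_succ', Nat.sub_add_cancel hn]] at h1
    exact Nat.eq_of_mul_eq_mul_left (by norm_num) h1
  have hAcard' : Fintype.card A = 2 ^ (n - 1) := by rw [← Nat.card_eq_fintype_card, hAcard]
  -- an element outside `A` and the coset decomposition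
  obtain ⟨x, hxA⟩ : ∃ x : K ≃ₐ[ℚ] K, x ∉ A := by
    by_contra h
    push Not at h
    have : A = ⊤ := (Subgroup.eq_top_iff' A).2 h
    rw [this, Subgroup.index_top] at hAidx
    exact absurd hAidx (by norm_num)
  have hcov : ∀ g : K ≃ₐ[ℚ] K, (∃ u : A, g = A.subtype u) ∨ (∃ u : A, g = A.subtype u * x) := by
    intro g
    by_cases hg : g ∈ A
    · exact Or.inl ⟨⟨g, hg⟩, rfl⟩
    · have hgx : g * x⁻¹ ∈ A := (Subgroup.mul_mem_iff_of_index_two hAidx).2 (iff_of_false hg (fun h => hxA (by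
        simpa using A.inv_mem h)))
      exact Or.inr ⟨⟨g * x⁻¹, hgx⟩, by rw [Subgroup.coe_subtype]; group⟩
  have hxq : x * x ∈ A := Subgroup.mul_self_mem_of_index_two hAidx x
  let θ : A ≃* A := MulAut.conjNormal x
  have hθ : ∀ u : A, x * A.subtype u = A.subtype (θ u) * x := fun u => by
    show x * (u : K ≃ₐ[ℚ] K) = (MulAut.conjNormal x u : K ≃ₐ[ℚ] K) * x
    rw [MulAut.conjNormal_apply, inv_mul_cancel_right]
  let q : A := ⟨x * x, hxq⟩
  let c' : A := ⟨c, hcA⟩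
  let v₀ : A := ⟨u₀, hu₀A⟩
  let v₁ : A := ⟨u₁, hu₁A⟩
  -- transport of the hypotheses into `A`
  have hmem : ∀ (w : A) (u : K ≃ₐ[ℚ] K) (hu : u ∈ A), w ∈ Subgroup.zpowers (⟨u, hu⟩ : A) ↔ (w : K ≃ₐ[ℚ] K) ∈ Subgroup.zpowers u :=
    fun w u hu => UniqueInvolution.mem_zpowers_mk_iff hu w
  have hcv₀ : c' ∉ Subgroup.zpowers v₀ := fun h => hcu₀ ((hmem c' u₀ hu₀A).1 h)
  have hcv₁ : c' ∉ Subgroup.zpowers v₁ := fun h => hcu₁ ((hmem c' u₁ hu₁A).1 h)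
  have hv₀1 : v₀ ≠ 1 := fun h => hu₀ (congrArg Subtype.val h)
  have hind' : v₁ ∉ Subgroup.closure ({v₀, c'} : Set A) := by
    intro h
    apply hind
    have h1 : (A.subtype v₁) ∈ (Subgroup.closure ({v₀, c'} : Set A)).map A.subtype := Subgroup.mem_map_of_mem _ h
    rw [MonoidHom.map_closure] at h1
    have h2 : (A.subtype '' ({v₀, c'} : Set A)) = ({u₀, c} : Set (K ≃ₐ[ℚ] K)) := by
      rw [Set.image_pair]
      rfl
    rw [h2] at h1
    exact h1
  have hint' : ∀ w : A, w ∈ Subgroup.zpowers v₀ → w ∈ Subgroup.zpowers v₁ → w = 1 := fun w h₀ h₁ =>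
    Subtype.ext (hint w ((hmem w u₀ hu₀A).1 h₀) ((hmem w u₁ hu₁A).1 h₁))
  have hθU : θ v₀ ∉ Subgroup.zpowers v₁ := by
    intro h
    have h1 := (hmem (θ v₀) u₁ hu₁A).1 h
    have h2 : ((θ v₀ : A) : K ≃ₐ[ℚ] K) = x * u₀ * x⁻¹ := MulAut.conjNormal_apply x v₀
    rw [h2] at h1
    exact hconjU x h1
  have hQ₀' : 4 * orderOf v₀ < Fintype.card A := by rw [hAcard', Subgroup.orderOf_mk]; exact hQ₀
  have hQ₁' : 4 * orderOf v₁ < Fintype.card A := by rw [hAcard', Subgroup.orderOf_mk]; exact hQ₁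
  exact SplitInvolution.exists_simple_degenerate_of_two_cyclic (MulEquiv.refl (K ≃ₐ[ℚ] K)) A.subtype Subtype.coe_injective x
    (fun u h => hxA (h ▸ u.2)) hcov θ hθ q rfl c' rfl v₀ v₁ hcv₀ hcv₁ hv₀1 hind' hint' hθU hQ₀' hQ₁'

/-- **GOOD ⟹ an abelian subgroup of index two containing `c` has at most three involutions** (`[K:ℚ] = 2^n ≥ 64`): if
`t₁ ∈ A` is an involution other than `c`, then every involution `t₂ ∈ A` lies in `⟨t₁, c⟩ = {1, t₁, c, t₁c}` (were `c, t₁, t₂`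
independent, the field would be BAD: all involutions are central (gen 32) and `u₀ = t₁`, `u₁ = t₂` satisfy the two-cyclic
criterion). [cite: Shimura1998, §8.2 Prop. 26 and §32.10] [cite: Kubota1965, §2 and §4 Lemma 2] -/
theorem mem_closure_of_involutions_of_index_two_abelian {n : ℕ} (hdeg : Module.finrank ℚ K = 2 ^ n) (hn : 6 ≤ n)
    (hgood : ∀ (Φ : CMType K) (φ : K →+* ℂ), IsPrimitive (ℂ ≃+* ℂ) Φ.1 φ → IsNondegenerate Φ)
    (A : Subgroup (K ≃ₐ[ℚ] K)) (hAidx : A.index = 2) (hcommA : ∀ u ∈ A, ∀ v ∈ A, u * v = v * u)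
    (hcA : (IsCMField.complexConj K).restrictScalars ℚ ∈ A) (t₁ t₂ : K ≃ₐ[ℚ] K) (ht₁A : t₁ ∈ A) (ht₂A : t₂ ∈ A)
    (ht₁ : t₁ * t₁ = 1) (ht₂ : t₂ * t₂ = 1) (ht₁1 : t₁ ≠ 1) (ht₁c : t₁ ≠ (IsCMField.complexConj K).restrictScalars ℚ) :
    t₂ ∈ Subgroup.closure ({t₁, (IsCMField.complexConj K).restrictScalars ℚ} : Set (K ≃ₐ[ℚ] K)) := by
  classical
  by_contra ht₂ind
  set c := (IsCMField.complexConj K).restrictScalars ℚ with hc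
  have hcc : c * c = 1 := model_complexConj_mul_self (MulEquiv.refl (K ≃ₐ[ℚ] K)) (by simp [hc])
  have hc1 : c ≠ 1 := model_complexConj_ne_one (MulEquiv.refl (K ≃ₐ[ℚ] K)) (by simp [hc])
  have h64 : 64 ≤ 2 ^ n := le_trans (by norm_num) (Nat.pow_le_pow_right (by norm_num) hn : 2 ^ 6 ≤ 2 ^ n)
  have h52 : 52 ≤ Module.finrank ℚ K := by rw [hdeg]; omega
  have ht₁cen : ∀ g : K ≃ₐ[ℚ] K, g * t₁ = t₁ * g := fun g =>
    commute_of_involution_of_forall_isNondegenerate_of_le h52 hgood t₁ ht₁ g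
  have ht₂1 : t₂ ≠ 1 := fun h => ht₂ind (h ▸ Subgroup.one_mem _)
  have ht₂t₁ : t₂ ≠ t₁ := fun h => ht₂ind (h ▸ Subgroup.subset_closure (by simp))
  -- the two-cyclic criterion with `u₀ = t₁`, `u₁ = t₂`
  have hmemt : ∀ (s w : K ≃ₐ[ℚ] K), s * s = 1 → w ∈ Subgroup.zpowers s → w = 1 ∨ w = s := fun s w hss hw =>
    (mem_zpowers_iff_of_mul_self_eq_one hss w).1 hw
  have h2n : (2 : ℕ) * 4 < 2 ^ (n - 1) := by
    have : 2 ^ 5 ≤ 2 ^ (n - 1) := Nat.pow_le_pow_right (by norm_num) (by omega)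
    omega
  obtain ⟨Φ, φ, X, ι, ϑ, H1, H2, -⟩ := exists_simple_degenerate_of_index_two_pair hdeg (by omega) A hAidx hcommA hcA t₁ t₂ ht₁A
    ht₂A
    (fun h => by rcases hmemt t₁ c ht₁ h with h | h; exact hc1 h; exact ht₁c h.symm)
    (fun h => by
      rcases hmemt t₂ c ht₂ h with h | h
      · exact hc1 h
      · exact ht₂ind (h ▸ Subgroup.subset_closure (by simp)))
    ht₁1 ht₂ind
    (fun w hw₀ hw₁ => by
      rcases hmemt t₁ w ht₁ hw₀ with h | h
      · exact h
      · rcases hmemt t₂ w ht₂ hw₁ with h' | h'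
        · exact h'
        · exact absurd (h.symm.trans h') ht₂t₁.symm)
    (fun g h => by
      rw [ht₁cen g, mul_inv_cancel_right] at h
      rcases hmemt t₂ t₁ ht₂ h with h' | h'
      · exact ht₁1 h'
      · exact ht₂t₁ h'.symm)
    (by rw [orderOf_eq_prime (by rw [pow_two, ht₁]) ht₁1]; exact h2n)
    (by rw [orderOf_eq_prime (by rw [pow_two, ht₂]) ht₂1]; exact h2n)
  exact H2 (hgood Φ φ H1)

/-- **GOOD ⟹ an abelian subgroup of index two containing `c` has no `C₄ × C₄`** (`[K:ℚ] = 2^n ≥ 64`): any two elements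
`g₁, h₁ ∈ A` of order `4` have `⟨g₁⟩ ∩ ⟨h₁⟩ ≠ 1`.  (Otherwise the field is BAD: `c` is one of the involutions `g₁², h₁², g₁²h₁²` or
independent of them; in the last case `mem_closure_of_involutions_of_index_two_abelian` applies, in the first three the two-cyclic
criterion with `(u₀, u₁) = (h₁, g₁h₁), (g₁, g₁h₁), (g₁, h₁)`: a conjugate of `u₀` squares to the central involution `u₀²`, which is not
a square in `⟨u₁⟩`.) [cite: Shimura1998, §8.2 Prop. 26 and §32.10] [cite: Kubota1965, §2 and §4 Lemma 2] -/
theorem exists_mem_zpowers_of_order_four_of_index_two_abelian {n : ℕ} (hdeg : Module.finrank ℚ K = 2 ^ n) (hn : 6 ≤ n)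
    (hgood : ∀ (Φ : CMType K) (φ : K →+* ℂ), IsPrimitive (ℂ ≃+* ℂ) Φ.1 φ → IsNondegenerate Φ)
    (A : Subgroup (K ≃ₐ[ℚ] K)) (hAidx : A.index = 2) (hcommA : ∀ u ∈ A, ∀ v ∈ A, u * v = v * u)
    (hcA : (IsCMField.complexConj K).restrictScalars ℚ ∈ A) (g₁ h₁ : K ≃ₐ[ℚ] K) (hg₁A : g₁ ∈ A) (hh₁A : h₁ ∈ A)
    (hg4 : g₁ ^ 4 = 1) (hg2 : g₁ * g₁ ≠ 1) (hh4 : h₁ ^ 4 = 1) (hh2 : h₁ * h₁ ≠ 1) :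
    ∃ w : K ≃ₐ[ℚ] K, w ≠ 1 ∧ w ∈ Subgroup.zpowers g₁ ∧ w ∈ Subgroup.zpowers h₁ := by
  classical
  by_contra hneg
  push Not at hneg
  have hgh : ∀ w : K ≃ₐ[ℚ] K, w ∈ Subgroup.zpowers g₁ → w ∈ Subgroup.zpowers h₁ → w = 1 := fun w h1 h2 => by
    by_contra hw
    exact hneg w hw h1 h2
  set c := (IsCMField.complexConj K).restrictScalars ℚ with hc
  have hcc : c * c = 1 := model_complexConj_mul_self (MulEquiv.refl (K ≃ₐ[ℚ] K)) (by simp [hc])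
  have hc1 : c ≠ 1 := model_complexConj_ne_one (MulEquiv.refl (K ≃ₐ[ℚ] K)) (by simp [hc])
  have h64 : 64 ≤ 2 ^ n := le_trans (by norm_num) (Nat.pow_le_pow_right (by norm_num) hn : 2 ^ 6 ≤ 2 ^ n)
  have h52 : 52 ≤ Module.finrank ℚ K := by rw [hdeg]; omega
  have h4n : (4 : ℕ) * 4 < 2 ^ (n - 1) := by
    have : 2 ^ 5 ≤ 2 ^ (n - 1) := Nat.pow_le_pow_right (by norm_num) (by omega)
    omega
  -- notation and basic facts
  set g₀ := g₁ * g₁ with hg₀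
  set h₀ := h₁ * h₁ with hh₀
  have hcomm : g₁ * h₁ = h₁ * g₁ := hcommA g₁ hg₁A h₁ hh₁A
  have hsq4 : ∀ s : K ≃ₐ[ℚ] K, s ^ 4 = 1 → s * s * (s * s) = 1 := fun s hs => by
    rw [show s * s * (s * s) = s ^ 4 by simp only [pow_succ, pow_zero, one_mul, mul_assoc]]; exact hs
  have hg₀g₀ : g₀ * g₀ = 1 := hsq4 g₁ hg4
  have hh₀h₀ : h₀ * h₀ = 1 := hsq4 h₁ hh4
  have hg₀cen : ∀ g : K ≃ₐ[ℚ] K, g * g₀ = g₀ * g := fun g =>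
    commute_of_involution_of_forall_isNondegenerate_of_le h52 hgood g₀ hg₀g₀ g
  have hh₀cen : ∀ g : K ≃ₐ[ℚ] K, g * h₀ = h₀ * g := fun g =>
    commute_of_involution_of_forall_isNondegenerate_of_le h52 hgood h₀ hh₀h₀ g
  have hog : orderOf g₁ = 2 ^ 2 :=
    orderOf_eq_prime_pow (p := 2) (n := 1) (by rw [pow_one, pow_two]; exact hg2) (by rw [show 2 ^ (1 + 1) = 4 by norm_num]; exact hg4)
  have hoh : orderOf h₁ = 2 ^ 2 :=
    orderOf_eq_prime_pow (p := 2) (n := 1) (by rw [pow_one, pow_two]; exact hh2) (by rw [show 2 ^ (1 + 1) = 4 by norm_num]; exact hh4)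
  -- `g₀ ≠ h₀`
  have hg₀mem : g₀ ∈ Subgroup.zpowers g₁ := Subgroup.mul_mem _ (Subgroup.mem_zpowers _) (Subgroup.mem_zpowers _)
  have hh₀mem : h₀ ∈ Subgroup.zpowers h₁ := Subgroup.mul_mem _ (Subgroup.mem_zpowers _) (Subgroup.mem_zpowers _)
  have hg₀h₀ : g₀ ≠ h₀ := fun h => hg2 (hgh g₀ hg₀mem (h ▸ hh₀mem))
  -- elements of `⟨s⟩` for `s` of order `4`: `1, s, s², s³`; their squares are `1` or `s²`
  have hsq_mem : ∀ (s : K ≃ₐ[ℚ] K), s ^ 4 = 1 → ∀ w ∈ Subgroup.zpowers s, w * w = 1 ∨ w * w = s * s := by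
    intro s hs w hw
    obtain ⟨i, rfl⟩ := Subgroup.mem_zpowers_iff.1 hw
    rw [← (Commute.refl s).mul_zpow]
    exact zpow_eq_one_or_eq_of_mul_self_eq_one (hsq4 s hs) i
  -- the generic kill: `u₀, u₁ ∈ A` of order `4`, `⟨u₀⟩ ∩ ⟨u₁⟩ = 1`, `u₀² ≠ u₁²`, `c ∉ ⟨u₀⟩`, `c ∉ ⟨u₁⟩`, `u₁ ∉ ⟨u₀, c⟩`
  have hkill : ∀ u₀ u₁ : K ≃ₐ[ℚ] K, u₀ ∈ A → u₁ ∈ A → u₀ ^ 4 = 1 → u₀ * u₀ ≠ 1 → u₁ ^ 4 = 1 → u₁ * u₁ ≠ 1 →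
      (∀ g : K ≃ₐ[ℚ] K, g * (u₀ * u₀) = (u₀ * u₀) * g) → u₀ * u₀ ≠ u₁ * u₁ →
      (∀ w : K ≃ₐ[ℚ] K, w ∈ Subgroup.zpowers u₀ → w ∈ Subgroup.zpowers u₁ → w = 1) →
      c ∉ Subgroup.zpowers u₀ → c ∉ Subgroup.zpowers u₁ → u₁ ∉ Subgroup.closure ({u₀, c} : Set (K ≃ₐ[ℚ] K)) → False := by
    intro u₀ u₁ hu₀A hu₁A hu₀4 hu₀2 hu₁4 hu₁2 hu₀cen hsqne hint hcu₀ hcu₁ hind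
    have hou₀ : orderOf u₀ = 2 ^ 2 := orderOf_eq_prime_pow (p := 2) (n := 1) (by rw [pow_one, pow_two]; exact hu₀2)
      (by rw [show 2 ^ (1 + 1) = 4 by norm_num]; exact hu₀4)
    have hou₁ : orderOf u₁ = 2 ^ 2 := orderOf_eq_prime_pow (p := 2) (n := 1) (by rw [pow_one, pow_two]; exact hu₁2)
      (by rw [show 2 ^ (1 + 1) = 4 by norm_num]; exact hu₁4)
    obtain ⟨Φ, φ, X, ι, ϑ, H1, H2, -⟩ := exists_simple_degenerate_of_index_two_pair hdeg (by omega) A hAidx hcommA hcA u₀ u₁ hu₀A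
      hu₁A hcu₀ hcu₁ (fun h => hu₀2 (by rw [h, mul_one])) hind hint
      (fun g hg => by
        -- `(g u₀ g⁻¹)² = u₀²` is not a square in `⟨u₁⟩`
        have hsq : (g * u₀ * g⁻¹) * (g * u₀ * g⁻¹) = u₀ * u₀ := by
          rw [show g * u₀ * g⁻¹ * (g * u₀ * g⁻¹) = g * (u₀ * u₀) * g⁻¹ by group, hu₀cen g, mul_inv_cancel_right]
        rcases hsq_mem u₁ hu₁4 _ hg with h | h
        · rw [hsq] at h
          exact hu₀2 h
        · rw [hsq] at h
          exact hsqne h)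
      (by rw [hou₀]; exact h4n) (by rw [hou₁]; exact h4n)
    exact H2 (hgood Φ φ H1)
  -- divisibility from order `4`
  have hdiv : ∀ s : K ≃ₐ[ℚ] K, orderOf s = 2 ^ 2 → ∀ i : ℤ, s ^ i = 1 → (4 : ℤ) ∣ i := by
    intro s hs i h
    have := orderOf_dvd_iff_zpow_eq_one.2 h
    rw [hs] at this
    exact_mod_cast this
  have hord4 : ∀ s : K ≃ₐ[ℚ] K, s ^ 4 = 1 → s * s ≠ 1 → orderOf s = 2 ^ 2 := fun s hs hs2 =>
    orderOf_eq_prime_pow (p := 2) (n := 1) (by rw [pow_one, pow_two]; exact hs2)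
      (by rw [show 2 ^ (1 + 1) = 4 by norm_num]; exact hs)
  /- KEY CASE `c = p²` for an independent commuting pair `p, q` of order `4` in `A`: the pair `(u₀, u₁) = (q, p q)` -/
  have key : ∀ p q : K ≃ₐ[ℚ] K, p ∈ A → q ∈ A → p ^ 4 = 1 → p * p ≠ 1 → q ^ 4 = 1 → q * q ≠ 1 →
      (∀ w : K ≃ₐ[ℚ] K, w ∈ Subgroup.zpowers p → w ∈ Subgroup.zpowers q → w = 1) → c = p * p → False := by
    intro p q hpA hqA hp4 hp2 hq4 hq2 hpq hcp
    have hcomm : p * q = q * p := hcommA p hpA q hqA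
    have hCpq : Commute p q := hcomm
    have hop := hord4 p hp4 hp2
    have hoq := hord4 q hq4 hq2
    have hqqcen : ∀ g : K ≃ₐ[ℚ] K, g * (q * q) = (q * q) * g := fun g =>
      commute_of_involution_of_forall_isNondegenerate_of_le h52 hgood (q * q) (hsq4 q hq4) g
    have hpq4 : (p * q) ^ 4 = 1 := by rw [hCpq.mul_pow, hp4, hq4, one_mul]
    have hpqsq : p * q * (p * q) = p * p * (q * q) := by
      rw [show p * q * (p * q) = p * (q * p) * q by group, ← hcomm]; group
    have hone := CyclicTimesFour.one_of_zpow_mul_zpow_eq_one hpq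
    have hp2mem : p * p ∈ Subgroup.zpowers p := Subgroup.mul_mem _ (Subgroup.mem_zpowers p) (Subgroup.mem_zpowers p)
    refine hkill q (p * q) hqA (A.mul_mem hpA hqA) hq4 hq2 hpq4 ?_ hqqcen ?_ ?_ ?_ ?_ ?_
    · -- `(pq)² ≠ 1`
      rw [hpqsq]
      intro h
      have := hone 2 2 (by rw [zpow_two, zpow_two]; exact h)
      exact hp2 (by rw [← zpow_two]; exact this.1)
    · -- `q² ≠ (pq)² = p² q²`
      rw [hpqsq]
      intro h
      have h1 : 1 * (q * q) = p * p * (q * q) := by rw [one_mul]; exact h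
      exact hp2 (mul_right_cancel h1).symm
    · -- `⟨q⟩ ∩ ⟨pq⟩ = 1`
      intro w hwq hwpq
      obtain ⟨i, rfl⟩ := Subgroup.mem_zpowers_iff.1 hwpq
      rw [hCpq.mul_zpow] at hwq ⊢
      have hpi : p ^ i ∈ Subgroup.zpowers q := by
        have : p ^ i = (p ^ i * q ^ i) * (q ^ i)⁻¹ := by rw [mul_inv_cancel_right]
        rw [this]
        exact Subgroup.mul_mem _ hwq (Subgroup.inv_mem _ (Subgroup.zpow_mem _ (Subgroup.mem_zpowers q) i))
      have hpi1 : p ^ i = 1 := hpq _ (Subgroup.zpow_mem _ (Subgroup.mem_zpowers p) i) hpi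
      have h4i : (4 : ℤ) ∣ i := hdiv p hop i hpi1
      have hqi1 : q ^ i = 1 := by
        rw [← orderOf_dvd_iff_zpow_eq_one, hoq]; exact_mod_cast h4i
      rw [hpi1, hqi1, one_mul]
    · -- `c = p² ∉ ⟨q⟩`
      rw [hcp]
      intro h
      exact hp2 (hpq _ hp2mem h)
    · -- `c = p² ∉ ⟨pq⟩`
      rw [hcp]
      intro h
      obtain ⟨i, hi⟩ := Subgroup.mem_zpowers_iff.1 h
      rw [hCpq.mul_zpow] at hi
      have h1 : p ^ (i - 2) * q ^ i = 1 := by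
        calc p ^ (i - 2) * q ^ i = (p * p)⁻¹ * (p ^ i * q ^ i) := by group
          _ = 1 := by rw [hi, inv_mul_cancel]
      obtain ⟨h2, h3⟩ := hone (i - 2) i h1
      have := hdiv p hop _ h2
      have := hdiv q hoq _ h3
      omega
    · -- `pq ∉ ⟨q, p²⟩`
      rw [hcp]
      intro h
      have hqpp : q * (p * p) = p * p * q := hcommA q hqA (p * p) (A.mul_mem hpA hpA)
      obtain ⟨a, b, hab⟩ := CyclicTimesFour.exists_eq_zpow_mul_zpow hqpp h
      have h' : p * q = p ^ (2 * b) * q ^ a := by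
        rw [hab, ← zpow_two, ← zpow_mul, (hCpq.symm.zpow_zpow a (2 * b)).eq]
      have h1 : p ^ (1 - 2 * b) * q ^ (1 - a) = 1 := by
        calc p ^ (1 - 2 * b) * q ^ (1 - a) = p ^ (-(2 * b)) * (p * q) * q ^ (-a) := by group
          _ = 1 := by rw [h']; group
      obtain ⟨h2, -⟩ := hone _ _ h1
      have := hdiv p hop _ h2
      omega
  /- the position of `c` among `g₀ = g₁², h₀ = h₁², g₀ h₀` -/
  have hhg : ∀ w : K ≃ₐ[ℚ] K, w ∈ Subgroup.zpowers h₁ → w ∈ Subgroup.zpowers g₁ → w = 1 := fun w h₁' h₂' => hgh w h₂' h₁'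
  have hh₀1 : h₀ ≠ 1 := hh2
  have hg₀1 : g₀ ≠ 1 := hg2
  by_cases hc₁ : c = g₀
  · exact key g₁ h₁ hg₁A hh₁A hg4 hg2 hh4 hh2 hgh hc₁
  by_cases hc₂ : c = h₀
  · exact key h₁ g₁ hh₁A hg₁A hh4 hh2 hg4 hg2 hhg hc₂
  by_cases hc₃ : c = g₀ * h₀
  · /- `c = g₀ h₀`: the pair `(u₀, u₁) = (g₁, h₁)` -/
    have hCgh : Commute g₁ h₁ := hcomm
    have hone := CyclicTimesFour.one_of_zpow_mul_zpow_eq_one hgh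
    refine hkill g₁ h₁ hg₁A hh₁A hg4 hg2 hh4 hh2 hg₀cen hg₀h₀ hgh ?_ ?_ ?_
    · -- `g₀ h₀ ∉ ⟨g₁⟩`
      rw [hc₃]
      intro h
      have : h₀ ∈ Subgroup.zpowers g₁ := by
        have e : h₀ = g₀⁻¹ * (g₀ * h₀) := by rw [inv_mul_cancel_left]
        rw [e]
        exact Subgroup.mul_mem _ (Subgroup.inv_mem _ hg₀mem) h
      exact hh₀1 (hgh _ this hh₀mem)
    · -- `g₀ h₀ ∉ ⟨h₁⟩`
      rw [hc₃]
      intro h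
      have : g₀ ∈ Subgroup.zpowers h₁ := by
        have e : g₀ = (g₀ * h₀) * h₀⁻¹ := by rw [mul_inv_cancel_right]
        rw [e]
        exact Subgroup.mul_mem _ h (Subgroup.inv_mem _ hh₀mem)
      exact hg₀1 (hgh _ hg₀mem this)
    · -- `h₁ ∉ ⟨g₁, g₀h₀⟩`
      rw [hc₃]
      intro h
      have hcomm' : g₁ * (g₀ * h₀) = g₀ * h₀ * g₁ := by
        rw [← mul_assoc, hg₀cen g₁, mul_assoc, hh₀cen g₁, ← mul_assoc]
      obtain ⟨a, b, hab⟩ := CyclicTimesFour.exists_eq_zpow_mul_zpow hcomm' h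
      have hgh₀ : (g₀ * h₀) ^ b = g₁ ^ (2 * b) * h₁ ^ (2 * b) := by
        rw [hg₀, hh₀, ← zpow_two, ← zpow_two, (hCgh.zpow_zpow 2 2).mul_zpow, ← zpow_mul, ← zpow_mul]
      have h1 : g₁ ^ (a + 2 * b) * h₁ ^ (2 * b - 1) = 1 := by
        calc g₁ ^ (a + 2 * b) * h₁ ^ (2 * b - 1) = (g₁ ^ a * (g₁ ^ (2 * b) * h₁ ^ (2 * b))) * h₁⁻¹ := by group
          _ = 1 := by rw [← hgh₀, ← hab, mul_inv_cancel]
      obtain ⟨-, h2⟩ := hone _ _ h1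
      have := hdiv h₁ hoh _ h2
      omega
  · /- `c, g₀, h₀` independent: three involutions in `A` -/
    have h := mem_closure_of_involutions_of_index_two_abelian hdeg hn hgood A hAidx hcommA hcA g₀ h₀
      (A.mul_mem hg₁A hg₁A) (A.mul_mem hh₁A hh₁A) hg₀g₀ hh₀h₀ hg₀1 (Ne.symm hc₁)
    have hcomm' : g₀ * c = c * g₀ := hg₀cen c |>.symm ▸ (hg₀cen c).symm
    obtain ⟨a, b, hab⟩ := CyclicTimesFour.exists_eq_zpow_mul_zpow (hg₀cen c).symm h
    rcases zpow_eq_one_or_eq_of_mul_self_eq_one hg₀g₀ a with ha | ha <;>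
      rcases zpow_eq_one_or_eq_of_mul_self_eq_one hcc b with hb | hb <;> rw [ha, hb] at hab
    · exact hh₀1 (by rw [hab, one_mul])
    · exact hc₂ (by rw [hab, one_mul])
    · exact hg₀h₀ (by rw [hab, mul_one])
    · -- `h₀ = g₀ c ⟹ c = g₀ h₀`
      exact hc₃ (by rw [hab, ← mul_assoc, hg₀g₀, one_mul])

end Summit.HodgeConjecture.CorCM.GaloisModels
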